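import Summits.AnomalousDissipation.AnomalousDissipation.Theorems.SawtoothPulseCascadeK1LocalisedCascadeCTGSocket
import Summits.AnomalousDissipation.AnomalousDissipation.Theorems.SawtoothPulseCascadeK1LocalisedCascadeVOJunkBound
import Summits.AnomalousDissipation.AnomalousDissipation.Theorems.SawtoothPulseCascadeK1LocalisedCascadeTailCorollary

set_option linter.dupNamespace false

/-!
# K1loc′ — `K1Localised P (γ² − 3)` AT `γ = 8`, `(d, N₀, ρ_N) = (2, 1, 2)`, `0 < δ₀ ≤ 2⁻¹⁰⁰`, UNCONDITIONALLY («CT-GEO», closer B of record)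

Prover lane on the crux `K1LocalisedCascade` (stmt-AnomalousDissipation-19491), route `SawtoothPulseCascade` (S-D fibre ledger;
arbiter A25-2: closer B = road of record).  The K1loc′ chain assembled end to end, every row a theorem of the tree:
* row 1 (phase 1, ad-k1loc-p3): `…VOJunkBound.vo_junk_le` — `j_V + j_O ≤ 0.01496` (401 per-H-fibre certificates), with
  `…PhaseOneHSum.phaseOne_jH_le`, `…PhaseOneJunkSplit.phaseTwo_start20_le_of_junk` inside `…CTGSocket`;
* rows 2–3 (phases 2, 3, this lane): the all-orders corner-trace («CT-GEO») windows `…PhaseStep2CTGNumeric`, `…PhaseStep3CTGNumeric`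
  (finding F-p1g9-1: the resolvent of the corner trace expanded to all orders has no residue term, so fat blocks carry the junk);
* rows 4–∞ (ad-k1loc-p2): `…TailFinalSharp.k1Localised_of_phase4_sharp`;
* the iterates `a_j, b_j` exist (`…TailCorollary.exists_iterates`).
Hence **`k1Localised_ctg`**: for every cascade parameter set with `γ = 8`, `d = 2`, `N₀ = 1`, `ρ_N = 2`, `0 < δ₀ ≤ 2⁻¹⁰⁰`,
`K1Localised P (γ² − 3)` — a fraction of the variance of `sin 2πx₁` is dissipated by the end of phase `J_{61}(κ) + A`, uniformly in
`κ ≤ κ₀`; `k1FixedFraction_ctg`: the route's by-time-1 predicate `K1FixedFraction P` (`…SawtoothCascade.K1FixedFraction_of_K1Localised`);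
`k1Localised_ctg_at`: the literal instance `K1Localised ⟨8, δ₀, 2, 1, 2⟩ (8² − 3)`.
HONEST FRAMING: this is K1loc′, NOT the crux `K1LocalisedCascade` (which quantifies `γ ∈ [5, 8]`, `ρ_N ∈ [2, 7]` at `δ₀ = ¼` and
includes `CascadeFieldSmooth`); rung-leaf credit on F-D1 route-2 only.  No definitions. [cite: DEIJ2022, (1.2)–(1.3)]
[cite: Grafakos2014, Prop. 3.1.2 (5), Prop. 3.2.7 (3)] [problem: turb]
-/

namespace Summit.AnomalousDissipation.AnomalousDissipation.Theorems.SawtoothPulseCascade.K1Window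

open MeasureTheory Set Filter Topology UnitAddTorus Function Complex Metric
open scoped Real ENNReal
open Literature.Analysis Literature.Analysis.FunctionSpaces Literature.Analysis.FunctionSpaces.Torus Literature.Analysis.FluidPDE
open Literature.Analysis.FluidPDE.ShearStage
open Literature.Analysis.FluidPDE.SawtoothCascade Literature.Analysis.FluidPDE.SawtoothCascade.CascadeParams

section Cascade

variable (P : CascadeParams)

/-- **K1loc′** (see the file header): `γ = 8`, `0 < δ₀ ≤ 2⁻¹⁰⁰`, `d = 2`, `N₀ = 1`, `ρ_N = 2` give `K1Localised P (γ² − 3)`.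
[cite: DEIJ2022, (1.2)–(1.3)] [cite: Grafakos2014, Prop. 3.2.7 (3)] -/
theorem k1Localised_ctg (hγ : P.γ = 8) (hδ₀ : 0 < P.δ₀) (hδ₀' : P.δ₀ ≤ (2 : ℝ)⁻¹ ^ 100) (hd : P.d = 2) (hN₀ : P.N₀ = 1)
    (hρN : P.ρN = 2) : K1Localised P (P.γ ^ 2 - 3) := by
  obtain ⟨a, b, has, h0, hb, hab⟩ := exists_iterates P hδ₀ (by rw [hd]; norm_num)
  have hδ30 : P.δ₀ ≤ (2 : ℝ)⁻¹ ^ 30 := hδ₀'.trans (by norm_num)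
  have hVO := K1Start.vo_junk_le P hγ hN₀ hρN hd hδ₀ hδ30 a b h0 hb hab
  exact k1Localised_of_vo_junk_ctg_at P hγ hδ₀ hd hN₀ hρN a b has h0 hb hab hδ₀' (hVO.trans (by norm_num))

/-- **The route's by-time-1 predicate at the K1loc′ parameters**: `K1FixedFraction P`. [cite: DEIJ2022, (1.2)–(1.3)] -/
theorem k1FixedFraction_ctg (hγ : P.γ = 8) (hδ₀ : 0 < P.δ₀) (hδ₀' : P.δ₀ ≤ (2 : ℝ)⁻¹ ^ 100) (hd : P.d = 2) (hN₀ : P.N₀ = 1)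
    (hρN : P.ρN = 2) : K1FixedFraction P :=
  K1FixedFraction_of_K1Localised P _ (k1Localised_ctg P hγ hδ₀ hδ₀' hd hN₀ hρN)

end Cascade

/-- **K1loc′, literal instance**: `K1Localised ⟨8, δ₀, 2, 1, 2⟩ (8² − 3)` for `0 < δ₀ ≤ 2⁻¹⁰⁰`. [cite: DEIJ2022, (1.2)–(1.3)] -/
theorem k1Localised_ctg_at {δ₀ : ℝ} (hδ₀ : 0 < δ₀) (hδ₀' : δ₀ ≤ (2 : ℝ)⁻¹ ^ 100) :
    K1Localised ⟨8, δ₀, 2, 1, 2⟩ (8 ^ 2 - 3) :=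
  k1Localised_ctg ⟨8, δ₀, 2, 1, 2⟩ rfl hδ₀ hδ₀' rfl rfl rfl

end Summit.AnomalousDissipation.AnomalousDissipation.Theorems.SawtoothPulseCascade.K1Window
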